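import Mathlib
import Summits.ResolutionOfSingularities.ResolutionOfSingularities.Theses.Descent
import Literature.AlgebraicGeometry.Resolution.DiscreteSeparableResidueLocalUniformization
import HarnessLib

/-!
# The pole dichotomy of one `p`-closed direction along a discrete place — typed companion of
# sub-plan §12 (`Lines/valuative-constant-step-singledirection.md`; lens-3 g9; crux `DescentPerfectToAll`,
# item stmt-ResolutionOfSingularities-0549; a sub-line workfile of the registered line
# `Lines/valuative_constant_step.lean`, successor of g8's `Lines/separated_layer_sketch.lean`;
# NOT a registered skeleton, no slot action; counted 0 — nothing here proves resolution of
# singularities in characteristic `p`, rung B stays OPEN).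

WHAT IS TYPED.  For a derivation `D` of `K/k` and a valuation ring `O`:
`IsPClosed p D` (`D^[p] = c • D`), `IsConstants D L` (`L` is the field of constants), `HasBoundedPoles O D`
(`g • D` maps `O` into `O` for some `g ≠ 0`; for discrete `O` this is `inf_{f ∈ O} v(Df) > −∞`),
`NonDegenerateOn O D A` (a `K`-multiple of `D` restricts to the finitely generated model `A ⊆ O` and takes
a value of valuation zero = a unit at the centre).  Paper results of §12 as `Prop`s:
* `BoundedPolesEscape p`  — LEMMA B0 + LEMMA B + THEOREM 1: an ADMISSIBLE `p`-closed direction with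
  BOUNDED poles (⟺ `K/K^D` defectless at `O`, Kuhlmann) gives a regular model (root layer over `K^D`).
* `FiniteResidueRelease p` — THEOREM 5 (A): finite residue field + one regular model ⟹ every `D ≠ 0`
  with UNBOUNDED poles is non-degenerate on some regular finitely generated model (all `d`).
* `NonDegenerateDatum p` — VISIBILITY (§11.2, Lean `invariantsRegularOfPClosedNonsingularDerivation`,
  0 sorry) packaged: `p`-closed `D` killing a uniformizer, non-degenerate on a regular model ⟹
  `HasRelRootLayerDatum p`.
* `ImmediateDescent p` — PROPOSITION T: regular models DESCEND finite purely inseparable extensions that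
  are IMMEDIATE at `O` (finite residue field).
* `FiniteResidueRelDatum p` — COROLLARY R2-fin (`d = 2`, finite residue ⟹ `HasRelRootLayerDatum p`;
  unconditional on paper: Lipman + Theorem 5 + Lemma B).
* `UnboundedPolesResidual p` — the rung-1 residual after §12: g8's `DefectNoRootBothDiscreteLU p`
  hypotheses + "every admissible `p`-closed direction has UNBOUNDED poles" (`K` immediate over every
  admissible corank-one bottom).
REV 2 (§12.8, same session): `PoleDichotomy p` — THEOREM 5♭ (SOFT pole dichotomy, all `d`, ANY residue
field, complete paper proof of six lines: a singular saturation extends to the next quadratic transform,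
so either some saturation has a unit value or `D(O) ⊆ O`); `Dim2RelDatum p` — COROLLARY R2 in full
(Conjecture R2 holds; the `d = 2` residual is EMPTY, `residualDim2_of_dim2`); `ImmediateDescentAll p` —
PROPOSITION T♭ (immediate purely inseparable extensions descend regular models, no residue hypothesis);
`DefectlessDescent p` — DD, the one statement separating inseparable LU from LU (lens answer, final
form; OPEN in `d ≥ 4`); `PStepDescent p` + kernel `pStepDescent_of`; `ReleaseDim2 p` (every `p`-closed
line on a regular surface germ is released along every zero-dimensional discrete arc — `d = 2` sanity
that the DD-method never stalls).
KERNEL (no sorry): `defectNoRootBoth_of_poles : RegularCatchAlongDiscrete → BoundedPolesEscape p →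
UnboundedPolesResidual p → DefectNoRootBothDiscreteLU p`; `residualDim2_of : FiniteResidueRelDatum p →
ResidualDim2Infinite p → ResidualDim2 p` (in `d = 2` only INFINITE purely inseparable residue towers can
meet the residual's hypotheses; `ResidualDim2 p` itself is a theorem by Lipman — the content is the
emptiness reading, Conjecture R2 of §11.3 for finite residue towers).
Vocabulary `HasRegularModel`, `SepGen`, `RegularCatchAlongDiscrete`, `IsUnifProjection`,
`IsDefectlessUnifProjection`, `DiscreteSepGenLU`, `relLU_of_model`, `HasRootLayerDatum`,
`HasRelRootLayerDatum`, `DefectNoRootBothDiscreteLU` are VERBATIM copies of g7/g8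
(`Lines/separated_layer_sketch.lean` rev 3; crux workfiles are not importable before a build) so that
signatures dedup.
Disproof.lean honoured: §8 (`not_invariantsRegular_withoutPClosed`) — every invariants statement here
carries `IsPClosed`; §3/§4 (no base change / change of constants: one `K`, one `k`, one `O`; the top `K₁`
of `ImmediateDescent` is descended FROM, never base-changed TO); §10 (regular, not smooth).  Negatives
stmt-16484/19085 and the 15 dead 0549 slugs: no fixed-level robustness (release levels form an
arithmetic progression depending on `D`), no sandwich, no constant swap.
Sources: Matsumura CRT Thm 27.3 (i) p.228 (Taylor basis); Kuhlmann, The defect (arXiv:1004.2135) p.5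
Ex. 4, p.6 Rem. 7 / Thm 8 / Ex. 5; Cutkosky–Kuhlmann arXiv:2306.04967 (Kähler differentials detect
defect; background); Temkin 2013 Thm 1.3.2 (tree `Temkin2013RelConclusion`, vendored fact, NOT used as a
proof); Lipman 1978 (surfaces); tree `Lines/pclosed_invariants_regular.lean`, `Lines/root_layer_criterion.lean`.
-/

noncomputable section

set_option linter.dupNamespace false

open Literature.AlgebraicGeometry.Resolution

namespace Summit.ResolutionOfSingularities.ResolutionOfSingularities.Cruxes.DescentPerfectToAll.SingleDirection

/-! ## Vocabulary (verbatim copies of `SeparatedLayer.*`, g7/g8) -/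

/-- ONE finitely generated `k`-model of `K` inside `O`, regular at the centre of `O` (g7, verbatim). -/
def HasRegularModel (k K : Type) [Field k] [Field K] [Algebra k K] (O : ValuationSubring K) : Prop :=
  ∃ (A : Subalgebra k K) (hA : A.toSubring ≤ O.toSubring), A.FG ∧ IsFractionRing A K ∧
    IsRegularLocalRing
      (Localization.AtPrime (Ideal.comap (Subring.inclusion hA) (IsLocalRing.maximalIdeal O)))

/-- `K/k` is SEPARABLY GENERATED (g7, verbatim). -/
def SepGen (k K : Type) [Field k] [Field K] [Algebra k K] : Prop :=
  ∃ (d : ℕ) (x : Fin d → K), IsTranscendenceBasis k x ∧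
    Algebra.IsSeparable (IntermediateField.adjoin k (Set.range x)) K



/-- g7's STUB T3 (verbatim, shared): the quadratic sequence along a discrete `O` exhausts it. -/
def RegularCatchAlongDiscrete : Prop :=
  ∀ (k K : Type) [Field k] [Field K] [Algebra k K], (⊤ : IntermediateField k K).FG →
    ∀ O : ValuationSubring K, (∀ c : k, algebraMap k K c ∈ O) → IsDiscreteValuationRing O →
      HasRegularModel k K O →
      ∀ Z : Finset K, (∀ z ∈ Z, z ∈ O) →
        ∃ (A : Subalgebra k K) (hA : A.toSubring ≤ O.toSubring), A.FG ∧ IsFractionRing A K ∧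
          (∀ z ∈ Z, z ∈ A) ∧
          IsRegularLocalRing
            (Localization.AtPrime (Ideal.comap (Subring.inclusion hA) (IsLocalRing.maximalIdeal O)))

/-- UNIFORMIZING PROJECTION: a rational subfield `F = k(s)`, `s ⊆ O` finite algebraically independent,
`K/F` finite, and a uniformizer `x` of `O` inside `F` (`e(O | O ∩ F) = 1`).  No residue of `O` is
prescribed, no separability is asked (= g7's `IsInertProjection` minus its residue and separability
clauses). -/
def IsUnifProjection (k : Type) {K : Type} [Field k] [Field K] [Algebra k K]
    (O : ValuationSubring K) (F : IntermediateField k K) (x : K) : Prop :=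
  (∃ s : Finset K, (∀ y ∈ s, y ∈ O) ∧ AlgebraicIndependent k (fun z : (s : Set K) => (z : K)) ∧
      F = IntermediateField.adjoin k (s : Set K)) ∧
  FiniteDimensional F K ∧
  x ∈ F ∧ O.valuation x < 1 ∧ (∀ t : K, O.valuation t < 1 → O.valuation t ≤ O.valuation x)


/-- DEFECTLESS uniformizing projection: additionally `O` is a finitely generated module over
`O ∩ K_s`, `K_s :=` the separable closure of `F` in `K` — said elementwise inside `K`: finitely many
`y ⊆ O` such that every `t ∈ O` is a combination `Σ cᵢ yᵢ` with `cᵢ ∈ O ∩ K_s`.  (For `O` discrete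
with `e(O | O ∩ F) = 1` this is `f(O | O ∩ K_s) = [K : K_s]`: NO DEFECT in the purely inseparable
layer `K/K_s`.  Automatic when `K/F` is separable: `K_s = K`, `y = {1}`.) -/
def IsDefectlessUnifProjection (k : Type) {K : Type} [Field k] [Field K] [Algebra k K]
    (O : ValuationSubring K) (F : IntermediateField k K) (x : K) : Prop :=
  IsUnifProjection k O F x ∧
  ∃ y : Finset K, (∀ i ∈ y, i ∈ O) ∧
    ∀ t : K, t ∈ O → ∃ c : K → K,
      (∀ i ∈ y, c i ∈ O ∧ c i ∈ separableClosure F K) ∧ t = ∑ i ∈ y, c i * i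

/-- CLEAN THEOREM 1 (paper, lens-3 g8; characteristic-free, residue-field-free): relative LU by
REGULAR models at EVERY discrete rank-one `O ∋ k` of a separably generated `K/k`. -/
def DiscreteSepGenLU : Prop :=
  ∀ (k K : Type) [Field k] [Field K] [Algebra k K], (⊤ : IntermediateField k K).FG →
    ∀ O : ValuationSubring K, (∀ c : k, algebraMap k K c ∈ O) → IsDiscreteValuationRing O →
      SepGen k K → RelLocalUniformization k K O


/-- From ONE regular model to relative LU along a discrete `O` (the T3 tail of every assembly). -/
theorem relLU_of_model (h3 : RegularCatchAlongDiscrete) {k K : Type} [Field k] [Field K]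
    [Algebra k K] (hfg : (⊤ : IntermediateField k K).FG) (O : ValuationSubring K)
    (hk : ∀ c : k, algebraMap k K c ∈ O) (hO : IsDiscreteValuationRing O)
    (hmodel : HasRegularModel k K O) : RelLocalUniformization k K O := by
  intro R hRfg hRfrac hRO
  obtain ⟨Z, hZ⟩ := hRfg
  have hZO : ∀ z ∈ Z, z ∈ O := by
    intro z hz
    have hzR : z ∈ R := by rw [← hZ]; exact Algebra.subset_adjoin hz
    exact hRO hzR
  obtain ⟨A, hA, hAfg, _hAfrac, hZA, hAreg⟩ := h3 k K hfg O hk hO hmodel Z hZO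
  refine ⟨A, hA, ?_, hAfg, hAreg⟩
  rw [← hZ]
  exact Algebra.adjoin_le (fun z hz => hZA z hz)

/-- A ROOT-LAYER DATUM for `(k, K, O)`: a subfield `L` (in the application `L = K_s`, the separable
closure of a uniformizing `k(s)`), a finitely generated `A ⊆ O ∩ L` with fraction field `L` whose
local ring `S` at the centre of `O` is REGULAR, and `z ∈ O` with `z^p ∈ A`, `L(z) = K`, such that
`z^p − c^p ∉ 𝔪_S²` for all `c ∈ S`.  (The last clause forces `z ∉ L`: `S` is normal.) -/
def HasRootLayerDatum (p : ℕ) (k K : Type) [Field k] [Field K] [Algebra k K]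
    (O : ValuationSubring K) : Prop :=
  ∃ (L : IntermediateField k K) (A : Subalgebra k K) (hA : A.toSubring ≤ O.toSubring) (z : K)
    (hz : z ^ p ∈ A.toSubring),
    (∀ a : K, a ∈ A → a ∈ L) ∧ A.FG ∧
    (∀ t : K, t ∈ L → ∃ a b : K, a ∈ A ∧ b ∈ A ∧ b ≠ 0 ∧ t = a / b) ∧
    z ∈ O ∧ IntermediateField.adjoin L ({z} : Set K) = ⊤ ∧
    IsRegularLocalRing
      (Localization.AtPrime (Ideal.comap (Subring.inclusion hA) (IsLocalRing.maximalIdeal O))) ∧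
    (∀ c : Localization.AtPrime (Ideal.comap (Subring.inclusion hA) (IsLocalRing.maximalIdeal O)),
      algebraMap A.toSubring
          (Localization.AtPrime (Ideal.comap (Subring.inclusion hA) (IsLocalRing.maximalIdeal O)))
          ⟨z ^ p, hz⟩ - c ^ p ∉
        (IsLocalRing.maximalIdeal
          (Localization.AtPrime
            (Ideal.comap (Subring.inclusion hA) (IsLocalRing.maximalIdeal O)))) ^ 2)


/-- RELATIVE ROOT-LAYER DATUM at `O`: a rational uniformizing projection `F ∋ x` (so `K/F` finite),
an intermediate field `L ⊇ F`, a finitely generated `A ⊆ O ∩ L` with `Frac A = L` whose local ring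
`S` at the centre of `O` is regular, and `z ∈ O` with `z^p ∈ A`, `K` SEPARABLE over `L(z)`, and
LEMMA R's criterion for `z^p` at `S`. -/
def HasRelRootLayerDatum (p : ℕ) (k K : Type) [Field k] [Field K] [Algebra k K]
    (O : ValuationSubring K) : Prop :=
  ∃ (F L : IntermediateField k K) (x : K) (A : Subalgebra k K) (hA : A.toSubring ≤ O.toSubring)
    (z : K) (hz : z ^ p ∈ A.toSubring),
    IsUnifProjection k O F x ∧ F ≤ L ∧
    (∀ a : K, a ∈ A → a ∈ L) ∧ A.FG ∧
    (∀ t : K, t ∈ L → ∃ a b : K, a ∈ A ∧ b ∈ A ∧ b ≠ 0 ∧ t = a / b) ∧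
    z ∈ O ∧ Algebra.IsSeparable (IntermediateField.adjoin L ({z} : Set K)) K ∧
    IsRegularLocalRing
      (Localization.AtPrime (Ideal.comap (Subring.inclusion hA) (IsLocalRing.maximalIdeal O))) ∧
    (∀ c : Localization.AtPrime (Ideal.comap (Subring.inclusion hA) (IsLocalRing.maximalIdeal O)),
      algebraMap A.toSubring
          (Localization.AtPrime (Ideal.comap (Subring.inclusion hA) (IsLocalRing.maximalIdeal O)))
          ⟨z ^ p, hz⟩ - c ^ p ∉
        (IsLocalRing.maximalIdeal
          (Localization.AtPrime
            (Ideal.comap (Subring.inclusion hA) (IsLocalRing.maximalIdeal O)))) ^ 2)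

/-- THE RESIDUAL after ALL g8 levers: defect for every uniformizing projection, no root-layer datum,
no relative root-layer datum.  OPEN whether empty. -/
def DefectNoRootBothDiscreteLU (p : ℕ) : Prop :=
  ∀ (k K : Type) [Field k] [CharP k p] [Field K] [Algebra k K], (⊤ : IntermediateField k K).FG →
    ∀ O : ValuationSubring K, (∀ c : k, algebraMap k K c ∈ O) → IsDiscreteValuationRing O →
      (∀ t : K, t ∈ O → ∃ (c : k) (n : ℕ), O.valuation (t ^ p ^ n - algebraMap k K c) < 1) →
      (∃ t : K, t ∈ O ∧ ∀ c : k, 1 ≤ O.valuation (t - algebraMap k K c)) →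
      (¬ ∃ (F : IntermediateField k K) (x : K), IsDefectlessUnifProjection k O F x) →
      ¬ HasRootLayerDatum p k K O →
      ¬ HasRelRootLayerDatum p k K O →
        RelLocalUniformization k K O


/-! ## New vocabulary (g9): directions, poles, non-degeneracy -/

section Directions

variable {k K : Type} [Field k] [Field K] [Algebra k K]

/-- `D` is `p`-CLOSED: `D^p = c·D` for some `c ∈ K` (`D^p` as the `p`-fold iterate, itself a
derivation in characteristic `p`). -/
def IsPClosed (p : ℕ) (D : Derivation k K K) : Prop :=
  ∃ c : K, ∀ f : K, (⇑D)^[p] f = c * D f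

/-- `L` is the FIELD OF CONSTANTS `K^D` of `D` (said as a predicate, no subfield is constructed). -/
def IsConstants (D : Derivation k K K) (L : IntermediateField k K) : Prop :=
  ∀ f : K, f ∈ L ↔ D f = 0

/-- `D` has BOUNDED POLES on `O`: some nonzero multiple `g·D` maps `O` into `O`.  For a discrete
rank-one `O` this is `inf_{f ∈ O} v(D f) > −∞`; it depends only on the line `K·D`.  LEMMA B0 (§12.2,
paper): for `p`-closed `D ≠ 0`, bounded poles ⟺ `K/K^D` DEFECTLESS at `O` (and then `O` is free of
rank `p` over `O ∩ K^D`, Taylor basis); unbounded poles ⟺ `K/K^D` IMMEDIATE. -/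
def HasBoundedPoles (O : ValuationSubring K) (D : Derivation k K K) : Prop :=
  ∃ g : K, g ≠ 0 ∧ ∀ f : K, f ∈ O → g * D f ∈ O

/-- `D` is NON-DEGENERATE on the finitely generated model `A ⊆ O` at the centre of `O`: a nonzero
multiple `g·D` maps `A` into `A` and takes, on `A`, a value of valuation `1` (a unit of `O`, hence of the
local ring of `A` at the centre).  (§11.2: `g·D` is then the saturation there, up to a unit.) -/
def NonDegenerateOn (O : ValuationSubring K) (D : Derivation k K K) (A : Subalgebra k K) : Prop :=
  ∃ g : K, g ≠ 0 ∧ (∀ a : K, a ∈ A → g * D a ∈ A) ∧ ∃ a : K, a ∈ A ∧ O.valuation (g * D a) = 1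

/-- `trdeg_k K = 2`. -/
def TrdegTwo (k K : Type) [Field k] [Field K] [Algebra k K] : Prop :=
  ∃ x : Fin 2 → K, IsTranscendenceBasis k x

/-- The residue field of `O` is generated over `k` by the residues of finitely many elements
(for the zero-dimensional `O` of rung 1: `[κ(O) : k] < ∞`, the residue tower of every quadratic
sequence along `O` stabilises). -/
def FiniteResidue (k : Type) {K : Type} [Field k] [Field K] [Algebra k K]
    (O : ValuationSubring K) : Prop :=
  ∃ b : Finset K, (∀ y ∈ b, y ∈ O) ∧
    ∀ t : K, t ∈ O → ∃ q : K, q ∈ Algebra.adjoin k (b : Set K) ∧ O.valuation (t - q) < 1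

end Directions

/-! ## The paper results of §12 as `Prop`s -/

/-- LEMMA B0 + LEMMA B + THEOREM 1 (§12.2; paper; size M given Theorem 1's stubs): an ADMISSIBLE
(`K^D` separably generated over `k`) `p`-closed direction with BOUNDED poles on the discrete `O ∋ k`
yields a regular finitely generated model of `K` at the centre of `O` — the root layer `S[x]`
(`e = p`) or `S[t₀]` (`f = p`) over a regular model `S` of `K^D` along `O ∩ K^D` (LEMMA R, landed).
Why it might fail: only through Theorem 1 (`DiscreteSepGenLU`) for the bottom; the layer step is
LEMMA R with a 3-line value computation. -/
def BoundedPolesEscape (p : ℕ) : Prop :=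
  ∀ (k K : Type) [Field k] [CharP k p] [Field K] [Algebra k K], (⊤ : IntermediateField k K).FG →
    ∀ O : ValuationSubring K, (∀ c : k, algebraMap k K c ∈ O) → IsDiscreteValuationRing O →
    ∀ (D : Derivation k K K) (L : IntermediateField k K), D ≠ 0 → IsPClosed p D →
      IsConstants D L → SepGen k L → HasBoundedPoles O D →
        HasRegularModel k K O

/-- THEOREM 5 (A) (§12.3; paper, all `d`; typed for `k`-derivations): `O ∋ k` discrete with purely
inseparable algebraic residues (zero-dimensional) and FINITE residue field, ONE regular model given;
then every `D ≠ 0` with UNBOUNDED poles is non-degenerate on some regular finitely generated model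
(the quadratic transforms `T_n`, `n ≡ n₁ (mod p)`, `n ≫ 0`).  `p`-closedness is not needed.
Why it might fail: the bookkeeping "a derivation of `T_n` with a unit value is saturated and
non-degenerate" and the scaling `D(T_*) ⊆ T_*` (both routine); the engine is (12.3.1)–(12.3.3). -/
def FiniteResidueRelease (p : ℕ) : Prop :=
  ∀ (k K : Type) [Field k] [CharP k p] [Field K] [Algebra k K], (⊤ : IntermediateField k K).FG →
    ∀ O : ValuationSubring K, (∀ c : k, algebraMap k K c ∈ O) → IsDiscreteValuationRing O →
      (∀ t : K, t ∈ O → ∃ (c : k) (n : ℕ), O.valuation (t ^ p ^ n - algebraMap k K c) < 1) →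
      FiniteResidue k O → HasRegularModel k K O →
      ∀ D : Derivation k K K, D ≠ 0 → ¬ HasBoundedPoles O D →
        ∃ (A : Subalgebra k K) (hA : A.toSubring ≤ O.toSubring), A.FG ∧ IsFractionRing A K ∧
          IsRegularLocalRing
            (Localization.AtPrime (Ideal.comap (Subring.inclusion hA) (IsLocalRing.maximalIdeal O))) ∧
          NonDegenerateOn O D A

/-- VISIBILITY packaged (§11.2 (b) ⟹ (a) + §12.4; paper; the algebra is the landed
`invariantsRegularOfPClosedNonsingularDerivation`): a `p`-closed `D` killing a uniformizer `x` of `O`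
and non-degenerate on a regular finitely generated model `A ⊆ O` gives a `HasRelRootLayerDatum p`
(`L := K^D ∋ x`, `S := A_𝔭^{gD}` regular and essentially of finite type, `z :=` an element with
`gDz` a unit, criterion from the converse of LEMMA R, `F := k(x, s') ⊆ L` rational uniformizing).
Why it might fail: essential finite type of the ring of invariants (Eakin–Nagata + Artin–Tate; not in
Mathlib) and the converse half of LEMMA R (paper-trivial: embedding dimension). -/
def NonDegenerateDatum (p : ℕ) : Prop :=
  ∀ (k K : Type) [Field k] [CharP k p] [Field K] [Algebra k K], (⊤ : IntermediateField k K).FG →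
    ∀ O : ValuationSubring K, (∀ c : k, algebraMap k K c ∈ O) → IsDiscreteValuationRing O →
    ∀ D : Derivation k K K, D ≠ 0 → IsPClosed p D →
      (∃ x : K, D x = 0 ∧ O.valuation x < 1 ∧
        ∀ t : K, O.valuation t < 1 → O.valuation t ≤ O.valuation x) →
      (∃ (A : Subalgebra k K) (hA : A.toSubring ≤ O.toSubring), A.FG ∧ IsFractionRing A K ∧
          IsRegularLocalRing
            (Localization.AtPrime (Ideal.comap (Subring.inclusion hA) (IsLocalRing.maximalIdeal O))) ∧
          NonDegenerateOn O D A) →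
        HasRelRootLayerDatum p k K O

/-- PROPOSITION T (§12.5; paper, all `d`): regular finitely generated models DESCEND a finite purely
inseparable extension `K ⊆ K₁` that is IMMEDIATE at the discrete zero-dimensional `O₁` (every residue
of `O₁` and some uniformizer of `O₁` come from `K`), when the residue field is finite over `k`.
Proof on paper: refine to `p`-steps (all immediate), LEMMA B0 (immediate ⟹ unbounded poles),
THEOREM 5 (A), VISIBILITY.  This is the half of «inseparable LU ⟹ LU» that is formal; the other
half (DEFECTLESS steps of Temkin's tower) is what separates inseparable LU from LU (§12.5).
Why it might fail: as `FiniteResidueRelease` + essential finite type of invariants. -/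
def ImmediateDescent (p : ℕ) : Prop :=
  ∀ (k K K₁ : Type) [Field k] [CharP k p] [Field K] [Algebra k K] [Field K₁] [Algebra k K₁]
    [Algebra K K₁] [IsScalarTower k K K₁],
    (⊤ : IntermediateField k K).FG → FiniteDimensional K K₁ → IsPurelyInseparable K K₁ →
    ∀ O₁ : ValuationSubring K₁, (∀ c : k, algebraMap k K₁ c ∈ O₁) → IsDiscreteValuationRing O₁ →
      (∀ t : K, t ∈ O₁.comap (algebraMap K K₁) → ∃ (c : k) (n : ℕ),
          (O₁.comap (algebraMap K K₁)).valuation (t ^ p ^ n - algebraMap k K c) < 1) →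
      FiniteResidue k (O₁.comap (algebraMap K K₁)) →
      (∀ t : K₁, t ∈ O₁ → ∃ s : K, s ∈ O₁.comap (algebraMap K K₁) ∧
          O₁.valuation (t - algebraMap K K₁ s) < 1) →
      (∃ x : K, O₁.valuation (algebraMap K K₁ x) < 1 ∧
          ∀ t : K₁, O₁.valuation t < 1 → O₁.valuation t ≤ O₁.valuation (algebraMap K K₁ x)) →
      HasRegularModel k K₁ O₁ →
        HasRegularModel k K (O₁.comap (algebraMap K K₁))

/-- COROLLARY R2-fin (§12.4; paper, UNCONDITIONAL: Lipman + Abhyankar exhaustion + THEOREM 5 + LEMMA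
B0/B + VISIBILITY): `trdeg 2`, discrete zero-dimensional `O ∋ k` with FINITE residue field ⟹ a
relative root-layer datum exists.  Equivalently: Conjecture R2 (§11.3) holds for finite residue
towers.  Crux weight 0 (d = 2 is Lipman's theorem); recorded as mechanism completeness. -/
def FiniteResidueRelDatum (p : ℕ) : Prop :=
  ∀ (k K : Type) [Field k] [CharP k p] [Field K] [Algebra k K], (⊤ : IntermediateField k K).FG →
    ∀ O : ValuationSubring K, (∀ c : k, algebraMap k K c ∈ O) → IsDiscreteValuationRing O →
      TrdegTwo k K →
      (∀ t : K, t ∈ O → ∃ (c : k) (n : ℕ), O.valuation (t ^ p ^ n - algebraMap k K c) < 1) →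
      FiniteResidue k O →
        HasRelRootLayerDatum p k K O

/-- THE RESIDUAL OF RUNG 1 AFTER §12: g8's both-residual (defect for every uniformizing projection,
no root-layer datum, no relative root-layer datum) AND every ADMISSIBLE `p`-closed direction has
UNBOUNDED poles on `O` (`K` is IMMEDIATE over every admissible corank-one bottom `K^D`, LEMMA B0).
OPEN whether empty; in `d = 2` its members have infinite purely inseparable residue towers
(`residualDim2_of`). -/
def UnboundedPolesResidual (p : ℕ) : Prop :=
  ∀ (k K : Type) [Field k] [CharP k p] [Field K] [Algebra k K], (⊤ : IntermediateField k K).FG →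
    ∀ O : ValuationSubring K, (∀ c : k, algebraMap k K c ∈ O) → IsDiscreteValuationRing O →
      (∀ t : K, t ∈ O → ∃ (c : k) (n : ℕ), O.valuation (t ^ p ^ n - algebraMap k K c) < 1) →
      (∃ t : K, t ∈ O ∧ ∀ c : k, 1 ≤ O.valuation (t - algebraMap k K c)) →
      (¬ ∃ (F : IntermediateField k K) (x : K), IsDefectlessUnifProjection k O F x) →
      ¬ HasRootLayerDatum p k K O →
      ¬ HasRelRootLayerDatum p k K O →
      (∀ (D : Derivation k K K) (L : IntermediateField k K), D ≠ 0 → IsPClosed p D →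
          IsConstants D L → SepGen k L → ¬ HasBoundedPoles O D) →
        RelLocalUniformization k K O

/-- KERNEL (no sorry): T3 + LEMMA B (typed `BoundedPolesEscape`) + the §12 residual give g8's
both-residual, hence (g8 `DiscreteInseparableResidueLU_of₃`) rung 1 from P2, T3, P3, P3′. -/
theorem defectNoRootBoth_of_poles {p : ℕ} (h3 : RegularCatchAlongDiscrete)
    (hB : BoundedPolesEscape p) (hU : UnboundedPolesResidual p) : DefectNoRootBothDiscreteLU p := by
  intro k K _ _ _ _ hfg O hk hO h1 h2 hdef hroot hrel
  by_cases hex : ∃ (D : Derivation k K K) (L : IntermediateField k K), D ≠ 0 ∧ IsPClosed p D ∧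
      IsConstants D L ∧ SepGen k L ∧ HasBoundedPoles O D
  · obtain ⟨D, L, hD, hP, hC, hS, hb⟩ := hex
    exact relLU_of_model h3 hfg O hk hO (hB k K hfg O hk hO D L hD hP hC hS hb)
  · refine hU k K hfg O hk hO h1 h2 hdef hroot hrel ?_
    intro D L hD hP hC hS hb
    exact hex ⟨D, L, hD, hP, hC, hS, hb⟩

/-- The both-residual restricted to `trdeg 2` (a THEOREM by Lipman — stated only to carry the
emptiness reading of Conjecture R2). -/
def ResidualDim2 (p : ℕ) : Prop :=
  ∀ (k K : Type) [Field k] [CharP k p] [Field K] [Algebra k K], (⊤ : IntermediateField k K).FG →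
    ∀ O : ValuationSubring K, (∀ c : k, algebraMap k K c ∈ O) → IsDiscreteValuationRing O →
      TrdegTwo k K →
      (∀ t : K, t ∈ O → ∃ (c : k) (n : ℕ), O.valuation (t ^ p ^ n - algebraMap k K c) < 1) →
      (∃ t : K, t ∈ O ∧ ∀ c : k, 1 ≤ O.valuation (t - algebraMap k K c)) →
      (¬ ∃ (F : IntermediateField k K) (x : K), IsDefectlessUnifProjection k O F x) →
      ¬ HasRootLayerDatum p k K O →
      ¬ HasRelRootLayerDatum p k K O →
        RelLocalUniformization k K O

/-- R2∞ (§12.6): the `trdeg 2` both-residual on INFINITE purely inseparable residue towers — the only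
`d = 2` configurations not excluded by COROLLARY R2-fin. -/
def ResidualDim2Infinite (p : ℕ) : Prop :=
  ∀ (k K : Type) [Field k] [CharP k p] [Field K] [Algebra k K], (⊤ : IntermediateField k K).FG →
    ∀ O : ValuationSubring K, (∀ c : k, algebraMap k K c ∈ O) → IsDiscreteValuationRing O →
      TrdegTwo k K →
      (∀ t : K, t ∈ O → ∃ (c : k) (n : ℕ), O.valuation (t ^ p ^ n - algebraMap k K c) < 1) →
      (∃ t : K, t ∈ O ∧ ∀ c : k, 1 ≤ O.valuation (t - algebraMap k K c)) →
      (¬ ∃ (F : IntermediateField k K) (x : K), IsDefectlessUnifProjection k O F x) →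
      ¬ HasRootLayerDatum p k K O →
      ¬ HasRelRootLayerDatum p k K O →
      ¬ FiniteResidue k O →
        RelLocalUniformization k K O

/-- KERNEL (no sorry): COROLLARY R2-fin empties the finite-residue part of the `d = 2` residual. -/
theorem residualDim2_of {p : ℕ} (hF : FiniteResidueRelDatum p) (hI : ResidualDim2Infinite p) :
    ResidualDim2 p := by
  intro k K _ _ _ _ hfg O hk hO hd h1 h2 hdef hroot hrel
  by_cases hfin : FiniteResidue k O
  · exact absurd (hF k K hfg O hk hO hd h1 hfin) hrel
  · exact hI k K hfg O hk hO hd h1 h2 hdef hroot hrel hfin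

/-- KERNEL (no sorry): the both-residual implies its `trdeg 2` restriction (bookkeeping, for the probe). -/
theorem residualDim2_of_both {p : ℕ} (h : DefectNoRootBothDiscreteLU p) : ResidualDim2 p :=
  fun k K _ _ _ _ hfg O hk hO _ h1 h2 hdef hroot hrel => h k K hfg O hk hO h1 h2 hdef hroot hrel

/-! ## §12.8 (rev 2) — the SOFT pole dichotomy and its consequences

THEOREM 5♭ (paper, complete proof in §12.8.1 of the sub-plan; all `d`, ANY residue field, `p`-closedness
not used): let `O ∋ k` be discrete and zero-dimensional, `T₀ ⊆ O` ONE regular local model containing a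
uniformizer `x`, `D ≠ 0` a `k`-derivation.  Follow the quadratic transforms `T_n` of `T₀` along `O`
(all regular, `⋃ T_n = O`) and the saturations `D_n` of `D` on `T_n`.  If `D_n(T_n) ⊆ 𝔪_n` (singular)
then `D_n` extends to a derivation of `T_{n+1} = T_n[𝔪_n/x]_{P_{n+1}}` (because `D_n(𝔪_n) ⊆ 𝔪_n ⊆ xT_{n+1}`
and `D_n x ∈ 𝔪_n`), so `D = g_0 ⋯ g_n · D_n` with `g_i ∈ T_i`; hence EITHER some `D_n` has a unit value
(RELEASED: non-degenerate on the regular `T_n`) OR `D(T_n) ⊆ T_n` for every `n`, i.e. `D(O) ⊆ O`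
(BOUNDED POLES).  This removes the finite-residue hypothesis of THEOREM 5 (which survives as the
explicit-level form) and closes R2∞. -/

/-- THEOREM 5♭ (§12.8.1; paper, complete; all `d`, any residue field): one regular model + `D ≠ 0`
⟹ bounded poles OR released on a regular finitely generated model.
Why it might fail: only the bookkeeping «a derivation of a regular local ring with a unit value is,
after scaling by that unit, saturated and non-degenerate» (definition of `NonDegenerateOn`). -/
def PoleDichotomy (p : ℕ) : Prop :=
  ∀ (k K : Type) [Field k] [CharP k p] [Field K] [Algebra k K], (⊤ : IntermediateField k K).FG →
    ∀ O : ValuationSubring K, (∀ c : k, algebraMap k K c ∈ O) → IsDiscreteValuationRing O →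
      (∀ t : K, t ∈ O → ∃ (c : k) (n : ℕ), O.valuation (t ^ p ^ n - algebraMap k K c) < 1) →
      HasRegularModel k K O →
      ∀ D : Derivation k K K, D ≠ 0 →
        HasBoundedPoles O D ∨
        ∃ (A : Subalgebra k K) (hA : A.toSubring ≤ O.toSubring), A.FG ∧ IsFractionRing A K ∧
          IsRegularLocalRing
            (Localization.AtPrime (Ideal.comap (Subring.inclusion hA) (IsLocalRing.maximalIdeal O))) ∧
          NonDegenerateOn O D A

/-- KERNEL (no sorry): THEOREM 5♭ contains THEOREM 5 (A). -/
theorem finiteResidueRelease_of_dichotomy {p : ℕ} (h : PoleDichotomy p) : FiniteResidueRelease p := by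
  intro k K _ _ _ _ hfg O hk hO h1 _ hreg D hD hunb
  rcases h k K hfg O hk hO h1 hreg D hD with hb | hrel
  · exact absurd hb hunb
  · exact hrel

/-- COROLLARY R2 (§12.8.2; paper, UNCONDITIONAL via Lipman): Conjecture R2 of §11.3 holds in FULL —
every `trdeg 2`, discrete, zero-dimensional `O ∋ k` carries a relative root-layer datum (choose a
regular `T ∋ x`, a `p`-closed `k`-derivation `D ≠ 0` with `Dx = 0`; bounded poles ⟹ `f = p` ⟹ LEMMA B;
unbounded ⟹ THEOREM 5♭ releases ⟹ VISIBILITY = `NonDegenerateDatum`).  Hence NO `d = 2` configuration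
satisfies the hypotheses of the both-residual: the `d = 2` member hunt is closed. -/
def Dim2RelDatum (p : ℕ) : Prop :=
  ∀ (k K : Type) [Field k] [CharP k p] [Field K] [Algebra k K], (⊤ : IntermediateField k K).FG →
    ∀ O : ValuationSubring K, (∀ c : k, algebraMap k K c ∈ O) → IsDiscreteValuationRing O →
      TrdegTwo k K →
      (∀ t : K, t ∈ O → ∃ (c : k) (n : ℕ), O.valuation (t ^ p ^ n - algebraMap k K c) < 1) →
        HasRelRootLayerDatum p k K O

/-- KERNEL (no sorry): COROLLARY R2 contains COROLLARY R2-fin. -/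
theorem finiteResidueRelDatum_of_dim2 {p : ℕ} (h : Dim2RelDatum p) : FiniteResidueRelDatum p :=
  fun k K _ _ _ _ hfg O hk hO hd h1 _ => h k K hfg O hk hO hd h1

/-- KERNEL (no sorry): COROLLARY R2 empties the `d = 2` residual outright (its hypothesis
`¬ HasRelRootLayerDatum` is never met), in particular R2∞. -/
theorem residualDim2_of_dim2 {p : ℕ} (h : Dim2RelDatum p) : ResidualDim2 p :=
  fun k K _ _ _ _ hfg O hk hO hd h1 _ _ _ hrel => absurd (h k K hfg O hk hO hd h1) hrel

theorem residualDim2Infinite_of_dim2 {p : ℕ} (h : Dim2RelDatum p) : ResidualDim2Infinite p :=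
  fun k K _ _ _ _ hfg O hk hO hd h1 _ _ _ hrel _ => absurd (h k K hfg O hk hO hd h1) hrel

/-- PROPOSITION T♭ (§12.8.3; paper, complete; all `d`, ANY residue field): regular models DESCEND every
finite purely inseparable extension that is IMMEDIATE at `O₁` (refine to `p`-steps; LEMMA B0:
immediate ⟹ unbounded poles; THEOREM 5♭ ⟹ released; VISIBILITY).  `ImmediateDescent` minus the
finite-residue hypothesis. -/
def ImmediateDescentAll (p : ℕ) : Prop :=
  ∀ (k K K₁ : Type) [Field k] [CharP k p] [Field K] [Algebra k K] [Field K₁] [Algebra k K₁]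
    [Algebra K K₁] [IsScalarTower k K K₁],
    (⊤ : IntermediateField k K).FG → FiniteDimensional K K₁ → IsPurelyInseparable K K₁ →
    ∀ O₁ : ValuationSubring K₁, (∀ c : k, algebraMap k K₁ c ∈ O₁) → IsDiscreteValuationRing O₁ →
      (∀ t : K, t ∈ O₁.comap (algebraMap K K₁) → ∃ (c : k) (n : ℕ),
          (O₁.comap (algebraMap K K₁)).valuation (t ^ p ^ n - algebraMap k K c) < 1) →
      (∀ t : K₁, t ∈ O₁ → ∃ s : K, s ∈ O₁.comap (algebraMap K K₁) ∧
          O₁.valuation (t - algebraMap K K₁ s) < 1) →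
      (∃ x : K, O₁.valuation (algebraMap K K₁ x) < 1 ∧
          ∀ t : K₁, O₁.valuation t < 1 → O₁.valuation t ≤ O₁.valuation (algebraMap K K₁ x)) →
      HasRegularModel k K₁ O₁ →
        HasRegularModel k K (O₁.comap (algebraMap K K₁))

/-- KERNEL (no sorry). -/
theorem immediateDescent_of_all {p : ℕ} (h : ImmediateDescentAll p) : ImmediateDescent p :=
  fun k K K₁ _ _ _ _ _ _ _ _ hfg hfin hpi O₁ hk hO₁ h1 _ himm hunif hreg =>
    h k K K₁ hfg hfin hpi O₁ hk hO₁ h1 himm hunif hreg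

/-- DD — DEFECTLESS DESCENT (§12.8.4): THE statement that separates inseparable local uniformization
from local uniformization (lens-3 answer, final form).  `K ⊆ K₁` purely inseparable of degree `p`,
`O₁ ∋ k` discrete with zero-dimensional restriction, `O₁` FREE over `O = O₁ ∩ K` on `1, t, …, t^{p-1}`
(⟺ `e·f = p`, LEMMA B0), `K₁` has a regular local model along `O₁` ⟹ `K` has one along `O`.
OPEN in `d ≥ 4` (true in `d ≤ 3` because LU is); Frobenius-dual to «ascend an immediate `p`-step»
(§12.8.4); by §12.8.5 the natural method (point blow-ups upstairs + rings of invariants) never stalls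
in `d = 2`.  Together with PROPOSITION T♭ and Temkin 2013 Thm 1.3.2 (tree: `Temkin2013RelConclusion`)
it gives rung 1 (paper: iterate over the `log_p (e·f)` defectless steps of Temkin's extension).
Why it might fail: it is local uniformization of `K` at `O` in disguise unless the regular model
upstairs can be USED — the only handle is the `K`-line `∂_t`, which has NO poles on `O₁` and so gets no
help from THEOREM 5♭. -/
def DefectlessDescent (p : ℕ) : Prop :=
  ∀ (k K K₁ : Type) [Field k] [CharP k p] [Field K] [Algebra k K] [Field K₁] [Algebra k K₁]
    [Algebra K K₁] [IsScalarTower k K K₁],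
    (⊤ : IntermediateField k K).FG → FiniteDimensional K K₁ → Module.finrank K K₁ = p →
    IsPurelyInseparable K K₁ →
    ∀ O₁ : ValuationSubring K₁, (∀ c : k, algebraMap k K₁ c ∈ O₁) → IsDiscreteValuationRing O₁ →
      (∀ t : K, t ∈ O₁.comap (algebraMap K K₁) → ∃ (c : k) (n : ℕ),
          (O₁.comap (algebraMap K K₁)).valuation (t ^ p ^ n - algebraMap k K c) < 1) →
      (∃ t : K₁, t ∈ O₁ ∧ ∀ u : K₁, u ∈ O₁ → ∃ c : Fin p → K,
          (∀ i, c i ∈ O₁.comap (algebraMap K K₁)) ∧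
          u = ∑ i : Fin p, algebraMap K K₁ (c i) * t ^ (i : ℕ)) →
      HasRegularModel k K₁ O₁ →
        HasRegularModel k K (O₁.comap (algebraMap K K₁))

/-- ONE `p`-STEP DESCENT (§12.8.4): the dichotomy form «immediate OR defectless» (LEMMA B0 says every
degree-`p` purely inseparable step at a discrete `O₁` is one or the other; typed here as a hypothesis
so that the kernel below is pure logic). -/
def PStepDescent (p : ℕ) : Prop :=
  ∀ (k K K₁ : Type) [Field k] [CharP k p] [Field K] [Algebra k K] [Field K₁] [Algebra k K₁]
    [Algebra K K₁] [IsScalarTower k K K₁],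
    (⊤ : IntermediateField k K).FG → FiniteDimensional K K₁ → Module.finrank K K₁ = p →
    IsPurelyInseparable K K₁ →
    ∀ O₁ : ValuationSubring K₁, (∀ c : k, algebraMap k K₁ c ∈ O₁) → IsDiscreteValuationRing O₁ →
      (∀ t : K, t ∈ O₁.comap (algebraMap K K₁) → ∃ (c : k) (n : ℕ),
          (O₁.comap (algebraMap K K₁)).valuation (t ^ p ^ n - algebraMap k K c) < 1) →
      (((∀ t : K₁, t ∈ O₁ → ∃ s : K, s ∈ O₁.comap (algebraMap K K₁) ∧
            O₁.valuation (t - algebraMap K K₁ s) < 1) ∧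
        (∃ x : K, O₁.valuation (algebraMap K K₁ x) < 1 ∧
            ∀ t : K₁, O₁.valuation t < 1 → O₁.valuation t ≤ O₁.valuation (algebraMap K K₁ x))) ∨
       (∃ t : K₁, t ∈ O₁ ∧ ∀ u : K₁, u ∈ O₁ → ∃ c : Fin p → K,
          (∀ i, c i ∈ O₁.comap (algebraMap K K₁)) ∧
          u = ∑ i : Fin p, algebraMap K K₁ (c i) * t ^ (i : ℕ))) →
      HasRegularModel k K₁ O₁ →
        HasRegularModel k K (O₁.comap (algebraMap K K₁))

/-- KERNEL (no sorry): PROPOSITION T♭ + DD give one-step descent; i.e. modulo the (paper) LEMMA B0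
dichotomy and the (paper) iteration along Temkin's tower, DD is all that separates inseparable LU
from LU. -/
theorem pStepDescent_of {p : ℕ} (hI : ImmediateDescentAll p) (hD : DefectlessDescent p) :
    PStepDescent p := by
  intro k K K₁ _ _ _ _ _ _ _ _ hfg hfin hrk hpi O₁ hk hO₁ h1 hcase hreg
  rcases hcase with ⟨himm, hunif⟩ | hdef
  · exact hI k K K₁ hfg hfin hpi O₁ hk hO₁ h1 himm hunif hreg
  · exact hD k K K₁ hfg hfin hrk hpi O₁ hk hO₁ h1 hdef hreg

/-- RELEASE THEOREM in `d = 2` (§12.8.5; paper, via THEOREM 5♭ in the immediate case and, in the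
defectless case, Lipman + LEMMA R (`S'^{(j)}[t]` is regular and releases `∂_t`) + Abhyankar–Zariski
factorisation of birational domination between 2-dimensional REGULAR local rings): every `p`-closed
line on a regular surface germ becomes NON-DEGENERATE at the centre of ANY zero-dimensional discrete `O`
after finitely many point blow-ups along `O` (contrast characteristic 0: Euler's saddle-node stays
singular along its divergent separatrix).  Sanity statement: the DD-method never stalls in `d = 2`;
the factorisation step is what fails in `d ≥ 3`. -/
def ReleaseDim2 (p : ℕ) : Prop :=
  ∀ (k K : Type) [Field k] [CharP k p] [Field K] [Algebra k K], (⊤ : IntermediateField k K).FG →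
    ∀ O : ValuationSubring K, (∀ c : k, algebraMap k K c ∈ O) → IsDiscreteValuationRing O →
      TrdegTwo k K →
      (∀ t : K, t ∈ O → ∃ (c : k) (n : ℕ), O.valuation (t ^ p ^ n - algebraMap k K c) < 1) →
      HasRegularModel k K O →
      ∀ D : Derivation k K K, D ≠ 0 → IsPClosed p D →
        ∃ (A : Subalgebra k K) (hA : A.toSubring ≤ O.toSubring), A.FG ∧ IsFractionRing A K ∧
          IsRegularLocalRing
            (Localization.AtPrime (Ideal.comap (Subring.inclusion hA) (IsLocalRing.maximalIdeal O))) ∧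
          NonDegenerateOn O D A

/-! ## `∀ p` closures (probe targets) -/

def BoundedPolesEscapeAll : Prop := ∀ p : ℕ, p.Prime → BoundedPolesEscape p
def UnboundedPolesResidualAll : Prop := ∀ p : ℕ, p.Prime → UnboundedPolesResidual p
def DefectNoRootBothDiscreteLUAll : Prop := ∀ p : ℕ, p.Prime → DefectNoRootBothDiscreteLU p
def DefectlessDescentAll : Prop := ∀ p : ℕ, p.Prime → DefectlessDescent p
def ImmediateDescentAllPrimes : Prop := ∀ p : ℕ, p.Prime → ImmediateDescentAll p
def Dim2RelDatumAll : Prop := ∀ p : ℕ, p.Prime → Dim2RelDatum p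

theorem bothAll_of_polesAll (h3 : RegularCatchAlongDiscrete) (hB : BoundedPolesEscapeAll)
    (hU : UnboundedPolesResidualAll) : DefectNoRootBothDiscreteLUAll :=
  fun p hp => defectNoRootBoth_of_poles h3 (hB p hp) (hU p hp)


/-! ### §12.9 (rev 3): the clean residual CONSTANT step

By §12.9.1 (Frobenius transport: `PerfectRes` gives resolution after a finite purely inseparable
CONSTANT extension, regularity descending along the faithfully flat `Y ⊗ k^{perf} → Y_N`) and §12.9.2,
the local form of the crux is iterated one-constant-step descent; immediate constant steps are free
(`ImmediateDescentAll`, PROP T♭), and the generic residual one is the CLEAN constant step: `K₁ = K(t)`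
with `t ^ p ∈ k` and `O₁ = O[t]` free on `1, t, …, t^(p-1)` (residue field grows by `t̄`).  There DD is
POLE REMOVAL for the arithmetic vector field `∂/∂t` (`∂t = 1`, so `∂`-stable ⟹ non-singular), i.e.
`α_p`-equivariant local uniformization; Weil restriction / the `∂`-hull do NOT shortcut it (A₁ example,
§12.9.2 (f)).  Typed as the specialisation of `DefectlessDescent` with the extra hypothesis
«`t ^ p` is a constant»; the kernel is one line. -/

/-- CLEAN CONSTANT-STEP DESCENT (§12.9.2): `DefectlessDescent` restricted to steps generated by a
`p`-th root `t` of a CONSTANT `c : k` with `O₁` free over `O` on the powers of `t` (the clean `f = p`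
constant step: `c ∉ κ_O^p`).  Open in `d ≥ 4`; with `ImmediateDescentAll`, the two non-clean constant
types and CONJECTURE P of §12.9.2 it is the local content of the crux given `PerfectRes`. -/
def ConstantStepDescent (p : ℕ) : Prop :=
  ∀ (k K K₁ : Type) [Field k] [CharP k p] [Field K] [Algebra k K] [Field K₁] [Algebra k K₁]
    [Algebra K K₁] [IsScalarTower k K K₁],
    (⊤ : IntermediateField k K).FG → FiniteDimensional K K₁ → Module.finrank K K₁ = p →
    IsPurelyInseparable K K₁ →
    ∀ O₁ : ValuationSubring K₁, (∀ c : k, algebraMap k K₁ c ∈ O₁) → IsDiscreteValuationRing O₁ →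
      (∀ t : K, t ∈ O₁.comap (algebraMap K K₁) → ∃ (c : k) (n : ℕ),
          (O₁.comap (algebraMap K K₁)).valuation (t ^ p ^ n - algebraMap k K c) < 1) →
      (∃ t : K₁, t ∈ O₁ ∧ (∃ c : k, algebraMap k K₁ c = t ^ p) ∧ ∀ u : K₁, u ∈ O₁ → ∃ c : Fin p → K,
          (∀ i, c i ∈ O₁.comap (algebraMap K K₁)) ∧
          u = ∑ i : Fin p, algebraMap K K₁ (c i) * t ^ (i : ℕ)) →
      HasRegularModel k K₁ O₁ →
        HasRegularModel k K (O₁.comap (algebraMap K K₁))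

/-- Kernel (pure logic): defectless descent specialises to the clean constant step. -/
theorem constantStepDescent_of_defectless {p : ℕ} (h : DefectlessDescent p) :
    ConstantStepDescent p := by
  intro k K K₁ _ _ _ _ _ _ _ _ hfg hfd hrk hpi O₁ hk hdvr hzero hfree hreg
  obtain ⟨t, ht, _, hbasis⟩ := hfree
  exact h k K K₁ hfg hfd hrk hpi O₁ hk hdvr hzero ⟨t, ht, hbasis⟩ hreg

def ConstantStepDescentAll : Prop := ∀ p : ℕ, p.Prime → ConstantStepDescent p

theorem constantStepDescentAll_of (h : DefectlessDescentAll) : ConstantStepDescentAll :=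
  fun p hp => constantStepDescent_of_defectless (h p hp)

end Summit.ResolutionOfSingularities.ResolutionOfSingularities.Cruxes.DescentPerfectToAll.SingleDirection
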